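import Summits.BirchSwinnertonDyer.Rank1Residual.X11b.Three.OpenInputTight
import Summits.BirchSwinnertonDyer.Rank1Residual.X11b.SelmerRankOne
import Literature.NumberTheory.EllipticCurves.Rank1Residual.Typed.SelmerCardCertificate
import Literature.NumberTheory.EllipticCurves.Rank1Residual.Typed.PAdicCertificateMultiplicativeThree
import HarnessLib

/-!
# X11b at `p = 3` (team N8/O2, sub-target T3-TIGHT, part 2): the class-level reading on atom A1 and
# the per-pair INSTANCES of THE open input at `3` (cell `b2b-bsdres`, team `x11b3`, seat p7, gen 1)

HONEST FRAMING (verbatim, cell `b2b-bsdres`, run/shared/lean/b2b/bsd-rank1-residual/): the goal of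
the cell is to DELETE the COMBINATION-SHAPED residual classes for ALL analytic-rank `≤ 1` curves
over `ℚ` — "full BSD formula for every rank `≤ 1` curve in class `C`" assembled STRICTLY from
published theorems — so that the rank-`≤ 1` remainder becomes exactly the CONSTRUCTION-SHAPED
classes, which are TYPED (missing-input Props), NOT attempted; this is not "finishing BSD".
Research route (team N8/O2: STEP L at `3 ‖ N`); no claim beyond the stated class and loci; nothing
booked; X11b stays CONSTRUCTION-SHAPED and X11b@3 stays OPEN (RESIDUAL-MAP §I O2). THEOREMS ONLY;
no definition; no named fact; no `sorry`.

## What this file does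

`Three/OpenInputTight.lean` proves at every odd prime, `p = 3` included, that on the Locus
(`(E,p) ∈` X11b, (ram), `p ∤ ∏_ℓ c_ℓ(E)`) THE open input `P2OpenInputOnTreeOddAt W p` is EQUIVALENT to
`BSD(E,p)` given the twelve published facts of route p2 and the PUB-shaped control identity (odd form,
stated inline; its label — Castella 2018 Thm. 2.3 shape ⇐ JSW 2017 Thm. 3.3.1 printed for odd `p`,
`≤` half a tree theorem, `≥` half route R1's atom (P11), hypothesis only — is in that file's header and
in `P2.openInputOnTreeOddAt_of_bsdp_of_ram`). Here:

* §1 `P2.forall_openInputOnTreeOddAt_three_iff_forall_bsdp_of_locus` — the class-level reading on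
  census3's atom A1 (X11b@3 ∧ (ram) ∧ `3 ∤ ∏ c_ℓ`, 248 943 class-pairs `N < 5·10⁵`): "STEP L at `3`
  on A1" (the team's target restricted to A1) ⟺ "`BSD(E,3)` on A1", given the facts and the control
  identity at every pair. Reading for team N8/O2: on A1 no statement cheaper than `BSD(E,3)` can serve
  as STEP L at `3`, and a proof of STEP L at `3` there is worth exactly a proof of `BSD(E,3)` there.
* §2 INSTANCES: `P2.openInputOnTreeOddAt_three_of_card_selmerThree` — an X11b@3 pair with a (ram)
  prime carrying the per-curve certificate lines `#Sel^(3)(E/ℚ) = 3` and `ord_3 #Ш(E)_an = 0` (the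
  shape of the lane's T-SEL3 / SEL3X rows; consumer `Typed.X11.bsdp_three_of_card_selmerThree_pow`,
  Wuthrich Prop. 21 + GZK + modularity) SATISFIES the open input at `(E,3)`, given the control
  identity; `…_of_semistable_of_card_selmerThree` (the (ram) witness automatic on semistable curves,
  `ram_of_semistable_of_irr_of_le_seven`); `P2.openInputOnTreeOddAt_three_of_conductor_lt` (below
  `N = 5000`, Miller 2011 Thm. 1.2 via `IsX11Three.bsdp_three_of_conductor_lt`);
  `P2.openInputOnTreeOddAt_three_of_kolyvagin_of_card_selmer` (the `#Ш_an = 9` route of x11b gen 9: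
  `#Sel^(3) = 27` + a Heegner index of `3`-valuation `≤ 1`, `ClassX11b.bsdp_of_kolyvagin_of_card_selmer`).
  So the typed input cannot fail at any X11b@3 pair the lane has certified with a (ram) prime, and every
  such certificate is a verified instance of STEP L at `3` modulo the published facts and (CTL).
  Per-pair statements; NOT class theorems; the certificates themselves are the lane's, not reproduced.
* §3 `X11Three.missingInputAt_iff_openInputOnTreeOddAt_of_aprimeLocus` — the cell's TWO typed objects
  of record for O2, `X11Three.MissingInputAt W` (R6.2, the A′-shaped input, `Typed/X11Three.lean`) and
  `P2OpenInputOnTreeOddAt W 3` (route p2), are EQUIVALENT on an X11b@3 pair lying on Castella's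
  A′-locus with `3 ∤ ∏ c_ℓ` (given the facts and the control identity): both pass through `BSD(E,3)`.

What this is NOT: no claim about the open input at an uncertified pair; no label or mark touched; the
census X11b-1 relation is not used. Hypothesis-echo note (team REFEREE.md F2): no binder below carries
a prime threshold. CONDITIONAL; nothing booked.

References: [Castella2018] Thm. 2.3 (arXiv:1704.06608 p. 5), Thm. 3.2 (p. 9); [JetchevSkinnerWan2017]
Thm. 3.3.1, §7.4.1; [Skinner2016PacificMC] Thm. C and footnote 1; [Wuthrich2014] Prop. 21;
[Miller2011LMS] Def. 1.1, Thm. 1.2; [LawsonWuthrich2016] §5; team files `cells/x11b3/REFEREE.md`,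
`cells/x11b3/OWNERS.md` row T3-TIGHT.
-/

noncomputable section

open scoped Classical

open WeierstrassCurve NumberField IsDedekindDomain Field
open Literature.NumberTheory.EllipticCurves Literature.NumberTheory.EllipticCurves.GreenbergSelmer
  Literature.NumberTheory.EllipticCurves.ModularForms
  Literature.NumberTheory.EllipticCurves.Rank1Residual
  Literature.NumberTheory.EllipticCurves.Rank1Residual.Typed
  Literature.NumberTheory.EllipticCurves.Wuthrich2014
  Literature.NumberTheory.EllipticCurves.BalakrishnanEtAl2019
  Literature.NumberTheory.QuadraticFields.Quadratic
  Literature.NumberTheory.Automorphic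
  Literature.NumberTheory.GaloisRepresentations Literature.NumberTheory.GaloisCohomology
  Summit.BirchSwinnertonDyer.Rank1Residual.X11b.AcSelmer
  Summit.BirchSwinnertonDyer.Rank1Residual.X11b.LocBridge

namespace Summit.BirchSwinnertonDyer.Rank1Residual.X11b

/-! ### §1. Class-level reading at `3`: on atom A1 the team's target is worth exactly `BSD(E,3)` -/

section Reading

/-- **"STEP L at `3` on the Locus" ⟺ "`BSD(E,3)` on the Locus"** (the team's conjecture restricted to
atom A1 versus its goal there), given the twelve published facts and the PUB-shaped control identity
at `3` at every X11b@3 pair (odd form, inline; label as in `P2.openInputOnTreeOddAt_of_bsdp_of_ram`).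
Universal closure of `P2.openInputOnTreeOddAt_three_iff_bsdp_of_locus`. Reading for team N8/O2: on
A1 no statement cheaper than `BSD(E,3)` itself can serve as STEP L at `3`, and no proof of STEP L at
`3` there is anything less than a proof of `BSD(E,3)` there. CONDITIONAL bookkeeping; nothing booked;
X11b@3 stays OPEN. [cite: Castella2018, Thm. 2.3 (p. 5), Thm. 3.2 (p. 9)] [cite: JetchevSkinnerWan2017, §7.4.1 (pp. 30–31)]
[cite: Miller2011LMS, Def. 1.1] -/
theorem P2.forall_openInputOnTreeOddAt_three_iff_forall_bsdp_of_locus [Fact (Nat.Prime 3)]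
    (hGZ : ∀ (N : ℕ) [NeZero N] (W : WeierstrassCurve ℚ) (K : Type) [Field K] [NumberField K],
      gross_zagier N W K)
    (hKo : ∀ (N : ℕ) [NeZero N] (W : WeierstrassCurve ℚ) (K : Type) [Field K] [NumberField K],
      kolyvagin N W K)
    (hB : ∀ (N : ℕ) [NeZero N] (W : WeierstrassCurve ℚ) (K : Type) [Field K] [NumberField K],
      Kolyvagin1990_padicValNat_card_sha_le N W K)
    (hSk : Skinner2016.thmC_padicValRat_bsd_rank_zero) (hWu : sha_dvd_analyticSha)
    (hGZK : rank_eq_analyticRank_of_analyticRank_le_one) (hmod : hasEntireLFunction_rat)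
    (hnf : exists_isNewformOf) (hHL : HoffsteinLuo1997_exists_twist_L_one_ne_zero)
    (hMaz : mazur_not_dvd_maninConstant_of_odd)
    (hPT : ∀ (K : Type) [Field K] [NumberField K], poitouTate_sum_localTatePairing_eq_zero K)
    (hEP : ∀ (K : Type) [Field K] [NumberField K] (v : HeightOneSpectrum (𝓞 K)),
      localEulerPoincareCharacteristic (v.adicCompletion K))
    (hC : ∀ (W : WeierstrassCurve ℚ) [W.IsElliptic] [W.IsGloballyMinimal]
      (N : ℕ) [NeZero N] (K : Type) [Field K] [NumberField K]
      (Dt : ModularParametrizationData W N) (H : HeegnerDatum N (NumberField.discr K)) (ι : K →+* ℂ)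
      (P : (W.baseChange K).toAffine.Point),
      ClassX11b W 3 → Surj W 3 → W.conductorNorm ℤ = N → IsImaginaryQuadratic K →
      Odd (NumberField.discr K) → ¬ (3 : ℤ) ∣ NumberField.discr K → ¬ 3 ∣ Units.torsionOrder K →
      SatisfiesHeegnerHypothesis N K →
      (W.quadraticTwist (NumberField.discr K : ℚ)).entireLFunction 1 ≠ 0 →
      WeierstrassCurve.Affine.Point.map ι.toRatAlgHom P = heegnerPointComplex Dt H →
      ¬ (3 : ℤ) ∣ Dt.c → ¬ IsOfFinAddOrder P →
      ∀ (κ : ZpExtension K 3), κ.IsAnticyclotomic →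
        ∀ (γ : Field.absoluteGaloisGroup K) [Fact (κ.IsTopGenerator γ)]
          (𝔭 : HeightOneSpectrum (𝓞 K)) (h𝔭 : ((3 : ℕ) : 𝓞 K) ∈ 𝔭.asIdeal)
          (he : 𝔭.asIdeal.ramificationIdx (𝓞 ℚ) = 1) (hf : 𝔭.asIdeal.inertiaDeg (𝓞 ℚ) = 1),
          ControlOnTreeAt 3 κ 𝔭 γ (embAt K 3 𝔭 h𝔭 he hf) P) :
    (∀ (W : WeierstrassCurve ℚ) [W.IsElliptic] [W.IsGloballyMinimal],
        ClassX11b W 3 → Ram W 3 → ¬ 3 ∣ W.tamagawaProduct → P2OpenInputOnTreeOddAt W 3) ↔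
      (∀ (W : WeierstrassCurve ℚ) [W.IsElliptic] [W.IsGloballyMinimal],
        ClassX11b W 3 → Ram W 3 → ¬ 3 ∣ W.tamagawaProduct → BSDp W 3) := by
  refine ⟨fun h W _ _ hX hram htam ↦ ?_, fun h W _ _ hX hram htam ↦ ?_⟩
  · exact (P2.openInputOnTreeOddAt_three_iff_bsdp_of_locus W hGZ hKo hB hSk hWu hGZK hmod hnf hHL
      hMaz hPT hEP (hC W) hX hram htam).1 (h W hX hram htam)
  · exact (P2.openInputOnTreeOddAt_three_iff_bsdp_of_locus W hGZ hKo hB hSk hWu hGZK hmod hnf hHL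
      hMaz hPT hEP (hC W) hX hram htam).2 (h W hX hram htam)

end Reading

/-! ### §2. INSTANCES at `3`: every pair certified at `3` satisfies the open input (given control) -/

section Instances

variable (W : WeierstrassCurve ℚ) [W.IsElliptic] [W.IsGloballyMinimal]

omit [W.IsElliptic] in
/-- At `p = 3` an X11b pair is an X11 pair of the tree's v3 predicate (`ClassX11`: the disjunct
`r = 1 ∧ p = 3`). Bookkeeping. [folklore] -/
theorem classX11_three_of_classX11b [Fact (Nat.Prime 3)] (hX : ClassX11b W 3) : ClassX11 W 3 :=
  ⟨hX.2.2.1, hX.2.2.2, Or.inr (Or.inr ⟨hX.1, rfl⟩)⟩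

/-- **INSTANCE of the open input at `3` from an EXACT `3`-Selmer certificate** (the shape of the
lane's T-SEL3 / SEL3X rows; consumer `Typed.X11.bsdp_three_of_card_selmerThree_pow`). For an X11b@3
pair with a (ram) prime carrying the per-curve certificate lines `#Sel^(3)(E/ℚ) = 3` (`hcard`) and
`#Ш(E)_an = q` with `ord_3 q = 0` (`hq`, `hv`): `BSD(E,3)` holds (Wuthrich 2014 Prop. 21, GZK,
modularity — published), hence, given the PUB-shaped control identity at `3` (odd form, inline; label
as in `P2.openInputOnTreeOddAt_of_bsdp_of_ram`; Gross–Zagier, Kolyvagin, Skinner 2016 Thm. C for the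
rigidity step), THE open input `P2OpenInputOnTreeOddAt W 3` HOLDS at this pair. Reading: every one of
the lane's certified X11b@3 classes is a verified instance of STEP L at `3` modulo the published facts
and (CTL); the typed input cannot fail there. A per-pair statement; NOT a class theorem; nothing booked.
[cite: Wuthrich2014, Prop. 21 (p. 400)] [cite: Miller2011LMS, §1 and Def. 1.1]
[cite: Castella2018, Thm. 2.3 (p. 5), Thm. 3.2 (p. 9)] [cite: Skinner2016PacificMC, Thm. C (§1) and footnote 1] -/
theorem P2.openInputOnTreeOddAt_three_of_card_selmerThree [Fact (Nat.Prime 3)]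
    (hGZ : ∀ (N : ℕ) [NeZero N] (W : WeierstrassCurve ℚ) (K : Type) [Field K] [NumberField K],
      gross_zagier N W K)
    (hKo : ∀ (N : ℕ) [NeZero N] (W : WeierstrassCurve ℚ) (K : Type) [Field K] [NumberField K],
      kolyvagin N W K)
    (hSk : Skinner2016.thmC_padicValRat_bsd_rank_zero) (hWu : sha_dvd_analyticSha)
    (hGZK : rank_eq_analyticRank_of_analyticRank_le_one) (hmod : hasEntireLFunction_rat)
    (hC : ∀ (N : ℕ) [NeZero N] (K : Type) [Field K] [NumberField K]
      (Dt : ModularParametrizationData W N) (H : HeegnerDatum N (NumberField.discr K)) (ι : K →+* ℂ)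
      (P : (W.baseChange K).toAffine.Point),
      ClassX11b W 3 → Surj W 3 → W.conductorNorm ℤ = N → IsImaginaryQuadratic K →
      Odd (NumberField.discr K) → ¬ (3 : ℤ) ∣ NumberField.discr K → ¬ 3 ∣ Units.torsionOrder K →
      SatisfiesHeegnerHypothesis N K →
      (W.quadraticTwist (NumberField.discr K : ℚ)).entireLFunction 1 ≠ 0 →
      WeierstrassCurve.Affine.Point.map ι.toRatAlgHom P = heegnerPointComplex Dt H →
      ¬ (3 : ℤ) ∣ Dt.c → ¬ IsOfFinAddOrder P →
      ∀ (κ : ZpExtension K 3), κ.IsAnticyclotomic →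
        ∀ (γ : Field.absoluteGaloisGroup K) [Fact (κ.IsTopGenerator γ)]
          (𝔭 : HeightOneSpectrum (𝓞 K)) (h𝔭 : ((3 : ℕ) : 𝓞 K) ∈ 𝔭.asIdeal)
          (he : 𝔭.asIdeal.ramificationIdx (𝓞 ℚ) = 1) (hf : 𝔭.asIdeal.inertiaDeg (𝓞 ℚ) = 1),
          ControlOnTreeAt 3 κ 𝔭 γ (embAt K 3 𝔭 h𝔭 he hf) P)
    (hX : ClassX11b W 3) (hram : Ram W 3)
    -- the per-curve certificate lines
    {q : ℚ} (hq : shaAn W = (q : ℂ)) (hv : padicValRat 3 q = 0)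
    (hcard : Nat.card (W.selmerGroup (3 : ℤ)) = 3) : P2OpenInputOnTreeOddAt W 3 :=
  P2.openInputOnTreeOddAt_of_bsdp_of_ram W 3 hGZ hKo hSk hGZK hmod hC hram
    (X11.bsdp_three_of_card_selmerThree_pow W hWu hGZK hmod (by rw [hX.1])
      (classX11_three_of_classX11b W hX) hq hv (by rw [hX.1, pow_one]; exact hcard))

/-- **INSTANCE of the open input at `3` on a SEMISTABLE X11b@3 pair from an exact `3`-Selmer
certificate** — as `P2.openInputOnTreeOddAt_three_of_card_selmerThree` with the (ram) witness
AUTOMATIC (`ram_of_semistable_of_irr_of_le_seven`; Diamond's refined level-lowering `hLL`). Per-pair;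
nothing booked. [cite: Wuthrich2014, Prop. 21 (p. 400)] [cite: Miller2011LMS, §1 and Def. 1.1] -/
theorem P2.openInputOnTreeOddAt_three_of_semistable_of_card_selmerThree [Fact (Nat.Prime 3)]
    (hGZ : ∀ (N : ℕ) [NeZero N] (W : WeierstrassCurve ℚ) (K : Type) [Field K] [NumberField K],
      gross_zagier N W K)
    (hKo : ∀ (N : ℕ) [NeZero N] (W : WeierstrassCurve ℚ) (K : Type) [Field K] [NumberField K],
      kolyvagin N W K)
    (hSk : Skinner2016.thmC_padicValRat_bsd_rank_zero) (hWu : sha_dvd_analyticSha)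
    (hGZK : rank_eq_analyticRank_of_analyticRank_le_one) (hmod : hasEntireLFunction_rat)
    (hnf : exists_isNewformOf) (hLL : Literature.NumberTheory.Automorphic.diamond1995_refinedSerre)
    (hC : ∀ (N : ℕ) [NeZero N] (K : Type) [Field K] [NumberField K]
      (Dt : ModularParametrizationData W N) (H : HeegnerDatum N (NumberField.discr K)) (ι : K →+* ℂ)
      (P : (W.baseChange K).toAffine.Point),
      ClassX11b W 3 → Surj W 3 → W.conductorNorm ℤ = N → IsImaginaryQuadratic K →
      Odd (NumberField.discr K) → ¬ (3 : ℤ) ∣ NumberField.discr K → ¬ 3 ∣ Units.torsionOrder K →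
      SatisfiesHeegnerHypothesis N K →
      (W.quadraticTwist (NumberField.discr K : ℚ)).entireLFunction 1 ≠ 0 →
      WeierstrassCurve.Affine.Point.map ι.toRatAlgHom P = heegnerPointComplex Dt H →
      ¬ (3 : ℤ) ∣ Dt.c → ¬ IsOfFinAddOrder P →
      ∀ (κ : ZpExtension K 3), κ.IsAnticyclotomic →
        ∀ (γ : Field.absoluteGaloisGroup K) [Fact (κ.IsTopGenerator γ)]
          (𝔭 : HeightOneSpectrum (𝓞 K)) (h𝔭 : ((3 : ℕ) : 𝓞 K) ∈ 𝔭.asIdeal)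
          (he : 𝔭.asIdeal.ramificationIdx (𝓞 ℚ) = 1) (hf : 𝔭.asIdeal.inertiaDeg (𝓞 ℚ) = 1),
          ControlOnTreeAt 3 κ 𝔭 γ (embAt K 3 𝔭 h𝔭 he hf) P)
    (hsst : Semistable W) (hX : ClassX11b W 3)
    {q : ℚ} (hq : shaAn W = (q : ℂ)) (hv : padicValRat 3 q = 0)
    (hcard : Nat.card (W.selmerGroup (3 : ℤ)) = 3) : P2OpenInputOnTreeOddAt W 3 :=
  P2.openInputOnTreeOddAt_three_of_card_selmerThree W hGZ hKo hSk hWu hGZK hmod hC hX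
    (ram_of_semistable_of_irr_of_le_seven hnf hLL W 3 hX.2.1 (by norm_num) hsst hX.2.2.2) hq hv hcard

/-- **INSTANCE of the open input at `3` below `N = 5000` (Miller 2011 Thm. 1.2 + Lawson–Wuthrich 2016
§5, the tree's named fact `bsdp_of_irreducible_of_conductor_lt`, via
`IsX11Three.bsdp_three_of_conductor_lt`)**: an X11b@3 pair with a (ram) prime and `N_E < 5000`
satisfies THE open input at `(E,3)`, given the PUB-shaped control identity at `3` (odd form, inline;
label as in `P2.openInputOnTreeOddAt_of_bsdp_of_ram`). Per-pair (72 of the 111 census pairs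
`N < 10⁴`); nothing booked. [cite: Miller2011LMS, Thm. 1.2] [cite: LawsonWuthrich2016, §5, Thm. 14 and Prop. 15] -/
theorem P2.openInputOnTreeOddAt_three_of_conductor_lt [Fact (Nat.Prime 3)]
    (hGZ : ∀ (N : ℕ) [NeZero N] (W : WeierstrassCurve ℚ) (K : Type) [Field K] [NumberField K],
      gross_zagier N W K)
    (hKo : ∀ (N : ℕ) [NeZero N] (W : WeierstrassCurve ℚ) (K : Type) [Field K] [NumberField K],
      kolyvagin N W K)
    (hSk : Skinner2016.thmC_padicValRat_bsd_rank_zero)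
    (hGZK : rank_eq_analyticRank_of_analyticRank_le_one) (hmod : hasEntireLFunction_rat)
    (hM : bsdp_of_irreducible_of_conductor_lt)
    (hC : ∀ (N : ℕ) [NeZero N] (K : Type) [Field K] [NumberField K]
      (Dt : ModularParametrizationData W N) (H : HeegnerDatum N (NumberField.discr K)) (ι : K →+* ℂ)
      (P : (W.baseChange K).toAffine.Point),
      ClassX11b W 3 → Surj W 3 → W.conductorNorm ℤ = N → IsImaginaryQuadratic K →
      Odd (NumberField.discr K) → ¬ (3 : ℤ) ∣ NumberField.discr K → ¬ 3 ∣ Units.torsionOrder K →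
      SatisfiesHeegnerHypothesis N K →
      (W.quadraticTwist (NumberField.discr K : ℚ)).entireLFunction 1 ≠ 0 →
      WeierstrassCurve.Affine.Point.map ι.toRatAlgHom P = heegnerPointComplex Dt H →
      ¬ (3 : ℤ) ∣ Dt.c → ¬ IsOfFinAddOrder P →
      ∀ (κ : ZpExtension K 3), κ.IsAnticyclotomic →
        ∀ (γ : Field.absoluteGaloisGroup K) [Fact (κ.IsTopGenerator γ)]
          (𝔭 : HeightOneSpectrum (𝓞 K)) (h𝔭 : ((3 : ℕ) : 𝓞 K) ∈ 𝔭.asIdeal)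
          (he : 𝔭.asIdeal.ramificationIdx (𝓞 ℚ) = 1) (hf : 𝔭.asIdeal.inertiaDeg (𝓞 ℚ) = 1),
          ControlOnTreeAt 3 κ 𝔭 γ (embAt K 3 𝔭 h𝔭 he hf) P)
    (hX : ClassX11b W 3) (hram : Ram W 3) (hN : W.conductorNorm ℤ < 5000) :
    P2OpenInputOnTreeOddAt W 3 :=
  P2.openInputOnTreeOddAt_of_bsdp_of_ram W 3 hGZ hKo hSk hGZK hmod hC hram
    (IsX11Three.bsdp_three_of_conductor_lt hM ⟨hX.2.2.1, hX.2.2.2, hX.1⟩ hN)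

/-- **INSTANCE of the open input at `3` on an X11b@3 pair with `ord_3 #Ш(E)_an = 2` from the
Kolyvagin + exact-`3`-Selmer route** (`ClassX11b.bsdp_of_kolyvagin_of_card_selmer`, x11b gen 9: LOWER
half `9 ∣ #Ш(E)` from `#Sel^(3)(E/ℚ) = 27`, UPPER half Kolyvagin's bound with a certified Heegner index of
`3`-valuation `≤ 1` at a classical Heegner field, `ρ̄_{E,3}` onto): such a pair, with a (ram) prime,
SATISFIES the open input at `(E,3)` given the PUB-shaped control identity at `3` (odd form, inline; label
as in `P2.openInputOnTreeOddAt_of_bsdp_of_ram`). The per-pair route the 7 + 33 `#Ш_an = 9` classes of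
the X11b@3 sweep residue wait on (RESIDUAL-MAP §H ⟦g5⟧); per-pair; nothing booked.
[cite: McCallumLMS1991, §1 Theorem (Kolyvagin), p. 296] [cite: Miller2011LMS, §1 and Def. 1.1] -/
theorem P2.openInputOnTreeOddAt_three_of_kolyvagin_of_card_selmer [Fact (Nat.Prime 3)]
    (hGZ : ∀ (N : ℕ) [NeZero N] (W : WeierstrassCurve ℚ) (K : Type) [Field K] [NumberField K],
      gross_zagier N W K)
    (hKo : ∀ (N : ℕ) [NeZero N] (W : WeierstrassCurve ℚ) (K : Type) [Field K] [NumberField K],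
      kolyvagin N W K)
    (hB : ∀ (N : ℕ) [NeZero N] (W : WeierstrassCurve ℚ) (K : Type) [Field K] [NumberField K],
      Kolyvagin1990_padicValNat_card_sha_le N W K)
    (hSk : Skinner2016.thmC_padicValRat_bsd_rank_zero)
    (hGZK : rank_eq_analyticRank_of_analyticRank_le_one) (hmod : hasEntireLFunction_rat)
    (hC : ∀ (N : ℕ) [NeZero N] (K : Type) [Field K] [NumberField K]
      (Dt : ModularParametrizationData W N) (H : HeegnerDatum N (NumberField.discr K)) (ι : K →+* ℂ)
      (P : (W.baseChange K).toAffine.Point),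
      ClassX11b W 3 → Surj W 3 → W.conductorNorm ℤ = N → IsImaginaryQuadratic K →
      Odd (NumberField.discr K) → ¬ (3 : ℤ) ∣ NumberField.discr K → ¬ 3 ∣ Units.torsionOrder K →
      SatisfiesHeegnerHypothesis N K →
      (W.quadraticTwist (NumberField.discr K : ℚ)).entireLFunction 1 ≠ 0 →
      WeierstrassCurve.Affine.Point.map ι.toRatAlgHom P = heegnerPointComplex Dt H →
      ¬ (3 : ℤ) ∣ Dt.c → ¬ IsOfFinAddOrder P →
      ∀ (κ : ZpExtension K 3), κ.IsAnticyclotomic →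
        ∀ (γ : Field.absoluteGaloisGroup K) [Fact (κ.IsTopGenerator γ)]
          (𝔭 : HeightOneSpectrum (𝓞 K)) (h𝔭 : ((3 : ℕ) : 𝓞 K) ∈ 𝔭.asIdeal)
          (he : 𝔭.asIdeal.ramificationIdx (𝓞 ℚ) = 1) (hf : 𝔭.asIdeal.inertiaDeg (𝓞 ℚ) = 1),
          ControlOnTreeAt 3 κ 𝔭 γ (embAt K 3 𝔭 h𝔭 he hf) P)
    (hX : ClassX11b W 3) (hram : Ram W 3)
    -- the per-curve certificate lines: a classical Heegner field, a non-torsion Heegner point with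
    -- `ord_3 [E(K) : ℤ P] ≤ 1`, `ord_3 #Ш(E)_an = 2`, `#Sel^(3)(E/ℚ) = 27`
    {N : ℕ} [NeZero N] {K : Type} [Field K] [NumberField K] (hK : IsImaginaryQuadratic K)
    (hH : SatisfiesHeegnerHypothesis N K) {P : (W.baseChange K).toAffine.Point}
    (hP : IsHeegnerPoint N W K P) (hnt : ¬ IsOfFinAddOrder P)
    (hI : padicValNat 3 (AddSubgroup.zmultiples P).index ≤ 1)
    {s : ℚ} (hs : shaAn W = (s : ℂ)) (hv : padicValRat 3 s = 2)
    (hcard : Nat.card (W.selmerGroup (3 : ℤ)) = 3 ^ 3) : P2OpenInputOnTreeOddAt W 3 :=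
  P2.openInputOnTreeOddAt_of_bsdp_of_ram W 3 hGZ hKo hSk hGZK hmod hC hram
    (ClassX11b.bsdp_of_kolyvagin_of_card_selmer W 3 hGZK hX (hKo N W K) (hB N W K) hK hH hP hnt
      (surj_of_irr_of_ram W 3 hX.2.2.2 hram) hI hs hv hcard)

end Instances

/-! ### §3. The two typed currencies of O2 agree where both apply -/

section Currencies

variable (W : WeierstrassCurve ℚ) [W.IsElliptic] [W.IsGloballyMinimal]

/-- **`X11Three.MissingInputAt W` (R6.2: the A′-SHAPED typed missing input at `(E,3)`,
`Typed/X11Three.lean`) ⟺ `P2OpenInputOnTreeOddAt W 3` (route p2's open input at `3`) on an X11b@3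
pair lying on BOTH loci** — Castella's A′-locus (`X11.AprimeLocusAt W 3`: a nonsplit multiplicative
`q ≠ 3` with `3 ∤ v_q(Δ_min)` and `E(ℚ_3)[3] = 0`; it implies (ram), `X11.ram_of_aprimeLocusAt`) and
`3 ∤ ∏_ℓ c_ℓ(E)` — given the twelve published facts and the PUB-shaped control identity at `3` (odd
form, inline; label as in `P2.openInputOnTreeOddAt_of_bsdp_of_ram`; used only in ⟹). Both pass
through `BSD(E,3)`: (⟹) `X11Three.bsdp_of_missingInputAt` then `P2.openInputOnTreeOddAt_of_bsdp_of_ram`;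
(⟸) `P2.bsdp_of_locus_endState_odd` then `X11Three.missingInputAt_of_bsdp`. Bookkeeping for team
N8/O2: the cell's two typed objects of record for O2 carry the same content on their common locus;
neither is asserted; X11b@3 stays OPEN. [cite: Castella2018Erratum, Thm. A′ (p. 1) (shape only; nothing asserted)]
[cite: Castella2018, Thm. 2.3 (p. 5), Thm. 3.2 (p. 9)] [cite: Miller2011LMS, §1 and Def. 1.1] -/
theorem X11Three.missingInputAt_iff_openInputOnTreeOddAt_of_aprimeLocus [Fact (Nat.Prime 3)]
    (hGZ : ∀ (N : ℕ) [NeZero N] (W : WeierstrassCurve ℚ) (K : Type) [Field K] [NumberField K],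
      gross_zagier N W K)
    (hKo : ∀ (N : ℕ) [NeZero N] (W : WeierstrassCurve ℚ) (K : Type) [Field K] [NumberField K],
      kolyvagin N W K)
    (hB : ∀ (N : ℕ) [NeZero N] (W : WeierstrassCurve ℚ) (K : Type) [Field K] [NumberField K],
      Kolyvagin1990_padicValNat_card_sha_le N W K)
    (hSk : Skinner2016.thmC_padicValRat_bsd_rank_zero) (hWu : sha_dvd_analyticSha)
    (hGZK : rank_eq_analyticRank_of_analyticRank_le_one) (hmod : hasEntireLFunction_rat)
    (hnf : exists_isNewformOf) (hHL : HoffsteinLuo1997_exists_twist_L_one_ne_zero)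
    (hMaz : mazur_not_dvd_maninConstant_of_odd)
    (hPT : ∀ (K : Type) [Field K] [NumberField K], poitouTate_sum_localTatePairing_eq_zero K)
    (hEP : ∀ (K : Type) [Field K] [NumberField K] (v : HeightOneSpectrum (𝓞 K)),
      localEulerPoincareCharacteristic (v.adicCompletion K))
    (hC : ∀ (N : ℕ) [NeZero N] (K : Type) [Field K] [NumberField K]
      (Dt : ModularParametrizationData W N) (H : HeegnerDatum N (NumberField.discr K)) (ι : K →+* ℂ)
      (P : (W.baseChange K).toAffine.Point),
      ClassX11b W 3 → Surj W 3 → W.conductorNorm ℤ = N → IsImaginaryQuadratic K →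
      Odd (NumberField.discr K) → ¬ (3 : ℤ) ∣ NumberField.discr K → ¬ 3 ∣ Units.torsionOrder K →
      SatisfiesHeegnerHypothesis N K →
      (W.quadraticTwist (NumberField.discr K : ℚ)).entireLFunction 1 ≠ 0 →
      WeierstrassCurve.Affine.Point.map ι.toRatAlgHom P = heegnerPointComplex Dt H →
      ¬ (3 : ℤ) ∣ Dt.c → ¬ IsOfFinAddOrder P →
      ∀ (κ : ZpExtension K 3), κ.IsAnticyclotomic →
        ∀ (γ : Field.absoluteGaloisGroup K) [Fact (κ.IsTopGenerator γ)]
          (𝔭 : HeightOneSpectrum (𝓞 K)) (h𝔭 : ((3 : ℕ) : 𝓞 K) ∈ 𝔭.asIdeal)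
          (he : 𝔭.asIdeal.ramificationIdx (𝓞 ℚ) = 1) (hf : 𝔭.asIdeal.inertiaDeg (𝓞 ℚ) = 1),
          ControlOnTreeAt 3 κ 𝔭 γ (embAt K 3 𝔭 h𝔭 he hf) P)
    (hX : ClassX11b W 3) (hloc : X11.AprimeLocusAt W 3) (htam : ¬ 3 ∣ W.tamagawaProduct) :
    X11Three.MissingInputAt W ↔ P2OpenInputOnTreeOddAt W 3 := by
  have hram : Ram W 3 := X11.ram_of_aprimeLocusAt hloc
  refine ⟨fun hmiss ↦ ?_, fun hA ↦ ?_⟩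
  · exact P2.openInputOnTreeOddAt_of_bsdp_of_ram W 3 hGZ hKo hSk hGZK hmod hC hram
      (X11Three.bsdp_of_missingInputAt hGZK W (le_of_eq hX.1) (classX11_three_of_classX11b W hX) hloc
        hmiss)
  · exact X11Three.missingInputAt_of_bsdp hmod hGZK W (le_of_eq hX.1)
      (P2.bsdp_of_locus_endState_odd W 3 hGZ hKo hB hSk hWu hGZK hmod hnf hHL hMaz hPT hEP hA hX hram
        htam)

end Currencies

end Summit.BirchSwinnertonDyer.Rank1Residual.X11b

end
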